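import Mathlib
import Summits.Ventures.HodgeRepro2.T5PadicOpenSubgroups

/-!
# T5PadicProductOpenSubgroups — open subgroups of `ℤ_p^ι` contain some `p^k ℤ_p^ι` and have p-power index

Cell pub-hodge-repro2, Tier 5 support (seat p7; route/T5-CHECK-G-p7.md §3 S2). S2 reads
«ν_κ is defined in print on Γ′ = rec_{Σ_p}(1 + pO_p) (Q13), open of finite p-power index in Γ⁻ ≅ ℤ_p^3
(index 1 iff p ∤ h_K^-, Q12)». The elementary half — «open ⇒ finite p-power index» in `Γ⁻ ≅ ℤ_p^d` — is
recorded here for `ι → ℤ_[p]` (`ι` finite), from T5PadicOpenSubgroups: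

* `ballSubgroup k = p^k ℤ_p^ι` is open, of index `p^{k·|ι|}` (`index_ballSubgroup`, Mathlib's
  `AddSubgroup.index_pi`);
* `exists_ballSubgroup_le_of_isOpen`: an open additive subgroup contains some `p^k ℤ_p^ι`
  (`exists_pow_smul_mem_of_isOpen`: `p^k x ∈ H` for every `x`);
* `exists_index_eq_pow_of_isOpen`: hence its index divides `p^{k·|ι|}` and is a power of `p`
  (`finiteIndex_of_isOpen`; `isClosed_of_isOpen`).

The identification `Γ⁻ ≅ ℤ_p^3` and the index-1 criterion `p ∤ h_K^-` are properties of the printed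
objects and stay prose. Mathlib + T5PadicOpenSubgroups only.
-/

namespace Summit.Ventures.HodgeRepro2.T5PadicProductOpenSubgroups

open PadicInt Filter Topology Metric
open Summit.Ventures.HodgeRepro2.T5PadicOpenSubgroups

variable {p : ℕ} [hp : Fact p.Prime] {ι : Type*} [Fintype ι]

/-- `p^k ℤ_p^ι ⊆ ℤ_p^ι`: the product of the ideals `p^k ℤ_p`, as an additive subgroup. -/
noncomputable abbrev ballSubgroup (k : ℕ) : AddSubgroup (ι → ℤ_[p]) :=
  AddSubgroup.pi Set.univ fun _ => (Ideal.span {(p : ℤ_[p]) ^ k}).toAddSubgroup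

omit [Fintype ι] in
/-- Membership in `p^k ℤ_p^ι`: every coordinate lies in `p^k ℤ_p`. -/
theorem mem_ballSubgroup (k : ℕ) (x : ι → ℤ_[p]) :
    x ∈ ballSubgroup k ↔ ∀ i, x i ∈ Ideal.span {(p : ℤ_[p]) ^ k} := by
  simp [ballSubgroup, AddSubgroup.mem_pi]

omit [Fintype ι] in
/-- `p^k • x ∈ p^k ℤ_p^ι` for every `x`. -/
theorem pow_smul_mem_ballSubgroup (k : ℕ) (x : ι → ℤ_[p]) :
    ((p : ℤ_[p]) ^ k) • x ∈ ballSubgroup k := by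
  rw [mem_ballSubgroup]
  intro i
  simp only [Pi.smul_apply, smul_eq_mul]
  exact Ideal.mul_mem_right _ _ (Ideal.mem_span_singleton_self _)

/-- `p^k ℤ_p^ι` is open (a finite product of open sets). -/
theorem isOpen_ballSubgroup (k : ℕ) : IsOpen ((ballSubgroup k : AddSubgroup (ι → ℤ_[p])) : Set (ι → ℤ_[p])) := by
  rw [AddSubgroup.coe_pi]
  exact isOpen_set_pi Set.finite_univ fun _ _ => isOpen_span_pow k

/-- `[ℤ_p^ι : p^k ℤ_p^ι] = p^{k·|ι|}` (Mathlib's `AddSubgroup.index_pi` and T5PadicOpenSubgroups'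
`index_span_pow`). -/
theorem index_ballSubgroup (k : ℕ) :
    (ballSubgroup k : AddSubgroup (ι → ℤ_[p])).index = p ^ (k * Fintype.card ι) := by
  rw [ballSubgroup, AddSubgroup.index_pi]
  simp only [index_span_pow, Finset.prod_const, Finset.card_univ, ← pow_mul]

/-- `p^k ℤ_p^ι` has finite index. -/
theorem finiteIndex_ballSubgroup (k : ℕ) : (ballSubgroup k : AddSubgroup (ι → ℤ_[p])).FiniteIndex :=
  ⟨by rw [index_ballSubgroup]; exact pow_ne_zero _ hp.out.ne_zero⟩

/-- An open additive subgroup of `ℤ_p^ι` contains `p^k ℤ_p^ι` for some `k`: it contains a ball about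
`0` for the sup metric, and `p^k ℤ_p^ι` is the closed ball of radius `p^{-k}`. -/
theorem exists_ballSubgroup_le_of_isOpen (H : AddSubgroup (ι → ℤ_[p]))
    (hH : IsOpen (H : Set (ι → ℤ_[p]))) : ∃ k : ℕ, ballSubgroup k ≤ H := by
  obtain ⟨ε, hε, hball⟩ := Metric.isOpen_iff.mp hH 0 H.zero_mem
  obtain ⟨k, hk⟩ := exists_pow_neg_lt p hε
  refine ⟨k, fun x hx => hball ?_⟩
  rw [mem_ballSubgroup] at hx
  rw [mem_ball, dist_pi_lt_iff hε]
  intro i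
  rw [Pi.zero_apply, dist_zero_right]
  exact lt_of_le_of_lt ((norm_le_pow_iff_mem_span_pow (x i) k).mpr (hx i)) hk

/-- «Γ′ ⊇ p^k Γ⁻»: for an open additive subgroup `H` of `ℤ_p^ι` there is `k` with `p^k x ∈ H` for
every `x`. -/
theorem exists_pow_smul_mem_of_isOpen (H : AddSubgroup (ι → ℤ_[p]))
    (hH : IsOpen (H : Set (ι → ℤ_[p]))) : ∃ k : ℕ, ∀ x : ι → ℤ_[p], ((p : ℤ_[p]) ^ k) • x ∈ H := by
  obtain ⟨k, hk⟩ := exists_ballSubgroup_le_of_isOpen H hH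
  exact ⟨k, fun x => hk (pow_smul_mem_ballSubgroup k x)⟩

/-- The index of an open additive subgroup of `ℤ_p^ι` divides `p^{k·|ι|}` for some `k`. -/
theorem exists_index_dvd_pow_of_isOpen (H : AddSubgroup (ι → ℤ_[p]))
    (hH : IsOpen (H : Set (ι → ℤ_[p]))) : ∃ k : ℕ, H.index ∣ p ^ (k * Fintype.card ι) := by
  obtain ⟨k, hk⟩ := exists_ballSubgroup_le_of_isOpen H hH
  refine ⟨k, ?_⟩
  rw [← index_ballSubgroup (ι := ι) k]
  exact AddSubgroup.index_dvd_of_le hk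

/-- S2's «open of finite p-power index in Γ⁻ ≅ ℤ_p^3»: an open additive subgroup of `ℤ_p^ι` has index
a power of `p`. -/
theorem exists_index_eq_pow_of_isOpen (H : AddSubgroup (ι → ℤ_[p]))
    (hH : IsOpen (H : Set (ι → ℤ_[p]))) : ∃ j : ℕ, H.index = p ^ j := by
  obtain ⟨k, hk⟩ := exists_index_dvd_pow_of_isOpen H hH
  obtain ⟨j, -, hj⟩ := (Nat.dvd_prime_pow hp.out).mp hk
  exact ⟨j, hj⟩

/-- An open additive subgroup of `ℤ_p^ι` has finite index. -/
theorem finiteIndex_of_isOpen (H : AddSubgroup (ι → ℤ_[p])) (hH : IsOpen (H : Set (ι → ℤ_[p]))) :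
    H.FiniteIndex := by
  obtain ⟨j, hj⟩ := exists_index_eq_pow_of_isOpen H hH
  exact ⟨by rw [hj]; exact pow_ne_zero _ hp.out.ne_zero⟩

omit [Fintype ι] in
/-- An open additive subgroup of `ℤ_p^ι` is closed. -/
theorem isClosed_of_isOpen (H : AddSubgroup (ι → ℤ_[p])) (hH : IsOpen (H : Set (ι → ℤ_[p]))) :
    IsClosed (H : Set (ι → ℤ_[p])) :=
  AddSubgroup.isClosed_of_isOpen H hH

/-- The quotient `ℤ_p^ι / H` of an open additive subgroup is finite. -/
theorem finite_quotient_of_isOpen (H : AddSubgroup (ι → ℤ_[p])) (hH : IsOpen (H : Set (ι → ℤ_[p]))) :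
    Finite ((ι → ℤ_[p]) ⧸ H) := by
  haveI := finiteIndex_of_isOpen H hH
  exact AddSubgroup.finite_quotient_of_finiteIndex

end Summit.Ventures.HodgeRepro2.T5PadicProductOpenSubgroups
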